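import Mathlib
import Summits.Ventures.HodgeRepro2.T6A1ComplexWeil

/-!
# T6A1WeilCEq — the interface's `weilC F` is the complex Weil summand; Lemma A1.3 over `ℂ` closed

Tier-6 sub-goal A1 (route/T6-A1-t6-p1.md §1 (A1.ii); TARGET-T6.md §2 Layer II). The interface defines
`weilC F = ⨆_σ ιW ℓ_{0,σ} · ιW ℓ_{1,σ} · ιW ℓ_{2,σ} · ιW ℓ_{3,σ}` (the product of the four eigenlines of
`σ`, TIER4 Def. A1.1 `w_σ = e_{1,σ} ∧ ⋯ ∧ e_{4,σ}`), while `T6A1ComplexWeil.weilSummandC'` is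
`⨆_σ ⋀⁴ V_σ` with `V_σ = ⊕_i ℓ_{i,σ}`. They agree (`weilC_eq_weilSummandC`): a wedge of four vectors of `V_σ` expands
multilinearly into wedges with one factor from each line (the others vanish, two factors from one line
being proportional), and conversely. Hence (`span_extC_weilQ_eq_weilC`) the `ℂ`-span of the
complexified rational Weil line `weilQ K` IS the interface's `weilC F` — TIER4 Lemma A1.3 / Prop. A2.3(iv)
in the interface's own vocabulary (the binder (ii) of t6-p3's `A3_main`).
-/

namespace Summit.Ventures.HodgeRepro2.T6.A1WeilCEq

open Polynomial A1WeilProjector A1ProjData A1Monomials A2Model A1Complex A1ComplexWeil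
open scoped TensorProduct

/-- An alternating map vanishes on a family with two proportional entries. -/
theorem alternatingMap_eq_zero_of_smul {R M N ι : Type*} [CommRing R] [AddCommGroup M] [Module R M]
    [AddCommGroup N] [Module R N] [DecidableEq ι] (f : M [⋀^ι]→ₗ[R] N) (v : ι → M) {i j : ι}
    (hij : i ≠ j) (u : M) (a b : R) (hi : v i = a • u) (hj : v j = b • u) : f v = 0 := by
  have h1 : v = Function.update v i (a • u) := by rw [← hi, Function.update_eq_self]
  rw [h1, AlternatingMap.map_update_smul]
  have h2 : Function.update v i u = Function.update (Function.update v i u) j (b • u) := by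
    rw [← hj, ← Function.update_of_ne hij.symm u v, Function.update_eq_self]
  rw [h2, AlternatingMap.map_update_smul]
  rw [AlternatingMap.map_eq_zero_of_eq _ _ (i := i) (j := j) ?_ hij, smul_zero, smul_zero]
  rw [Function.update_of_ne hij, Function.update_self, Function.update_self]

variable (K : Type*) [Field K] [NumberField K]

omit [NumberField K] in
/-- The Weil multi-index `4·e_ρ` over `ℂ` as a natural-number vector. -/
theorem weilIdxC_val [DecidableEq (K →+* ℂ)] (ρ : K →+* ℂ) :
    (fun ρ' => (weilIdxC K 4 ρ ρ' : ℕ)) = Pi.single ρ 4 := by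
  funext ρ'
  by_cases h : ρ' = ρ <;> simp [weilIdxC, h]

/-- The product of the four eigenlines of `ρ` inside `H^*(B, ℂ)`. -/
noncomputable abbrev lineProd (ρ : K →+* ℂ) : Submodule ℂ (HBC K) :=
  ιW (eigenLine K 0 ρ) * ιW (eigenLine K 1 ρ) * ιW (eigenLine K 2 ρ) * ιW (eigenLine K 3 ρ)

/-- A wedge of one vector from each of the four lines lies in their product. -/
theorem ιMulti_mem_lineProd (ρ : K →+* ℂ) (u : Fin 4 → H1C K) (hu : ∀ i, u i ∈ eigenLine K i ρ) :
    ExteriorAlgebra.ιMulti ℂ 4 u ∈ lineProd K ρ := by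
  rw [ExteriorAlgebra.ιMulti_apply]
  simp only [List.ofFn_succ, List.ofFn_zero, List.prod_cons, List.prod_nil, mul_one,
    Fin.succ_zero_eq_one, Fin.succ_one_eq_two]
  have h3 : ExteriorAlgebra.ι ℂ (u 3) ∈ ιW (eigenLine K 3 ρ) := Submodule.mem_map_of_mem (hu 3)
  have h2 : ExteriorAlgebra.ι ℂ (u 2) ∈ ιW (eigenLine K 2 ρ) := Submodule.mem_map_of_mem (hu 2)
  have h1 : ExteriorAlgebra.ι ℂ (u 1) ∈ ιW (eigenLine K 1 ρ) := Submodule.mem_map_of_mem (hu 1)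
  have h0 : ExteriorAlgebra.ι ℂ (u 0) ∈ ιW (eigenLine K 0 ρ) := Submodule.mem_map_of_mem (hu 0)
  have : ExteriorAlgebra.ι ℂ (u 0) * (ExteriorAlgebra.ι ℂ (u 1) *
      (ExteriorAlgebra.ι ℂ (u 2) * ExteriorAlgebra.ι ℂ (u 3))) =
      ExteriorAlgebra.ι ℂ (u 0) * ExteriorAlgebra.ι ℂ (u 1) * ExteriorAlgebra.ι ℂ (u 2) *
        ExteriorAlgebra.ι ℂ (u 3) := by
    simp only [mul_assoc]
  rw [show (u (Fin.succ 2 : Fin 4)) = u 3 from rfl, this]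
  exact Submodule.mul_mem_mul (Submodule.mul_mem_mul (Submodule.mul_mem_mul h0 h1) h2) h3

/-- Every element of the product of the four lines is a combination of wedges `ι u₀ ι u₁ ι u₂ ι u₃`. -/
theorem lineProd_le (ρ : K →+* ℂ) (S : Submodule ℂ (HBC K))
    (hS : ∀ u : Fin 4 → H1C K, (∀ i, u i ∈ eigenLine K i ρ) →
      ExteriorAlgebra.ι ℂ (u 0) * ExteriorAlgebra.ι ℂ (u 1) * ExteriorAlgebra.ι ℂ (u 2) *
        ExteriorAlgebra.ι ℂ (u 3) ∈ S) :
    lineProd K ρ ≤ S := by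
  intro r hr
  refine Submodule.mul_induction_on hr (fun m hm n hn => ?_) fun x y hx hy => add_mem hx hy
  obtain ⟨u3, hu3, rfl⟩ := Submodule.mem_map.1 hn
  refine Submodule.mul_induction_on hm (fun m hm n hn => ?_) fun x y hx hy => by
    rw [add_mul]; exact add_mem hx hy
  obtain ⟨u2, hu2, rfl⟩ := Submodule.mem_map.1 hn
  refine Submodule.mul_induction_on hm (fun m hm n hn => ?_) fun x y hx hy => by
    rw [add_mul, add_mul]; exact add_mem hx hy
  obtain ⟨u1, hu1, rfl⟩ := Submodule.mem_map.1 hn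
  obtain ⟨u0, hu0, rfl⟩ := Submodule.mem_map.1 hm
  exact hS ![u0, u1, u2, u3] (fun i => by fin_cases i <;> assumption)

variable [IsGalois ℚ K] [DecidableEq (K →+* ℂ)] [DecidableEq (K →ₐ[ℚ] K)] [DecidableEq K]

omit [IsGalois ℚ K] [DecidableEq (K →ₐ[ℚ] K)] [DecidableEq K] in
/-- `⋀⁴ V_ρ` inside `H^*(B, ℂ)` is the product of the four lines `ℓ_{i,ρ}` (TIER4 Def. A1.1 / (A0.6):
`∧⁴ V_σ = ℂ · e_{1,σ} ∧ e_{2,σ} ∧ e_{3,σ} ∧ e_{4,σ}`). -/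
theorem piece_map_eq_lineProd (ρ : K →+* ℂ) :
    (piece (eigenSpace K) 4 fun ρ' => (weilIdxC K 4 ρ ρ' : ℕ)).map (⋀[ℂ]^4 (H1C K)).subtype =
      lineProd K ρ := by
  rw [weilIdxC_val, piece_single, LinearMap.range_eq_map, ← exteriorPower.ιMulti_span ℂ 4,
    Submodule.map_span, Submodule.map_span]
  apply le_antisymm
  · rw [Submodule.span_le]
    rintro _ ⟨_, ⟨_, ⟨w, rfl⟩, rfl⟩, rfl⟩
    rw [Submodule.subtype_apply, exteriorPower.map_apply_ιMulti, exteriorPower.ιMulti_apply_coe]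
    -- expand each w i = Σ_j single j ((w i) j), (w i) j ∈ eigenLineK K ρ
    have hw : ∀ i j, ((w i : H1C K) j) ∈ eigenLineK K ρ := fun i j =>
      (mem_eigenSpace K ρ (w i)).1 (w i).2 j
    have hexp : ∀ i, ((w i : H1C K)) = ∑ j, Pi.single j ((w i : H1C K) j) := fun i =>
      (Finset.univ_sum_single _).symm
    have : ExteriorAlgebra.ιMulti ℂ 4 (fun i => (w i : H1C K)) =
        ∑ t : Fin 4 → Fin 4, ExteriorAlgebra.ιMulti ℂ 4 fun i => Pi.single (t i) ((w i : H1C K) (t i)) := by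
      conv_lhs => rw [show (fun i => (w i : H1C K)) = fun i => ∑ j, Pi.single j ((w i : H1C K) j) from
        funext hexp]
      exact (ExteriorAlgebra.ιMulti ℂ 4).toMultilinearMap.map_sum (fun i j => Pi.single j ((w i : H1C K) j))
    change ExteriorAlgebra.ιMulti ℂ 4 (fun i => (w i : H1C K)) ∈ _
    rw [this]
    refine Submodule.sum_mem _ fun t _ => ?_
    by_cases ht : Function.Injective t
    · -- a permutation: the wedge has one factor in each line
      let e : Equiv.Perm (Fin 4) := Equiv.ofBijective t ht.bijective_of_finite
      have hperm : (fun i => Pi.single (t i) ((w i : H1C K) (t i))) =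
          (fun j => Pi.single j ((w (e.symm j) : H1C K) j)) ∘ e := by
        funext i
        simp only [Function.comp_apply]
        have : e i = t i := rfl
        rw [this, show e.symm (t i) = i from e.symm_apply_apply i]
      rw [hperm, AlternatingMap.map_perm, Units.smul_def]
      refine Submodule.smul_of_tower_mem _ _ (ιMulti_mem_lineProd K ρ _ fun j => ?_)
      exact ⟨_, hw _ j, rfl⟩
    · -- two factors in the same line: the wedge vanishes
      obtain ⟨i, i', hii', hne⟩ := Function.not_injective_iff.1 ht
      obtain ⟨v, -, hv⟩ := exists_eigenLineK_eq_span K ρ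
      have hmem : ∀ i, (Pi.single (t i) ((w i : H1C K) (t i)) : H1C K) ∈
          Submodule.span ℂ {(Pi.single (t i) v : H1C K)} := by
        intro i
        have := hw i (t i)
        rw [hv, Submodule.mem_span_singleton] at this
        obtain ⟨a, ha⟩ := this
        rw [Submodule.mem_span_singleton]
        exact ⟨a, by rw [← Pi.single_smul, ha]⟩
      obtain ⟨a, ha⟩ := Submodule.mem_span_singleton.1 (hmem i)
      obtain ⟨b, hb⟩ := Submodule.mem_span_singleton.1 (hmem i')
      rw [alternatingMap_eq_zero_of_smul (ExteriorAlgebra.ιMulti ℂ 4) _ hne (Pi.single (t i) v) a b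
        ha.symm (by rw [← hb, hii'])]
      exact zero_mem _
  · refine lineProd_le K ρ _ fun u hu => ?_
    have hmem : ∀ i, u i ∈ eigenSpace K ρ := fun i =>
      le_trans (le_iSup (fun i => eigenLine K i ρ) i) le_rfl (hu i)
    refine Submodule.subset_span ⟨_, ⟨_, ⟨fun i => ⟨u i, hmem i⟩, rfl⟩, rfl⟩, ?_⟩
    rw [Submodule.subtype_apply, exteriorPower.map_apply_ιMulti, exteriorPower.ιMulti_apply_coe,
      ExteriorAlgebra.ιMulti_apply]
    simp only [List.ofFn_succ, List.ofFn_zero, List.prod_cons, List.prod_nil, mul_one,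
      Fin.succ_zero_eq_one, Fin.succ_one_eq_two, Function.comp_apply, Submodule.subtype_apply]
    simp only [mul_assoc]
    rfl

omit [IsGalois ℚ K] [DecidableEq (K →ₐ[ℚ] K)] [DecidableEq K] in
/-- The interface's `weilC F` IS the complex Weil summand `⊕_σ ⋀⁴ V_σ` (TIER4 Def. A1.1). -/
theorem weilC_eq_weilSummandC (F : FaceSetting K) : weilC F = weilSummandC' K := by
  unfold weilC weilSummandC' weilSummandC
  rw [Submodule.map_iSup]
  exact iSup_congr fun ρ => (piece_map_eq_lineProd K ρ).symm

/-- LEMMA A1.3 over `ℂ`, in the interface's vocabulary (TIER4 Prop. A2.3(iv), `W_F(B) ⊗ ℂ = W_ℂ`): the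
`ℂ`-span of the complexified rational Weil line `weilQ K` is `weilC F`. -/
theorem span_extC_weilQ_eq_weilC (F : FaceSetting K) :
    Submodule.span ℂ (extC K '' (weilQ K : Set (HB K))) = weilC F := by
  rw [span_extC_weilQ, weilC_eq_weilSummandC]

end Summit.Ventures.HodgeRepro2.T6.A1WeilCEq
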